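import Summits.BirchSwinnertonDyer.BirchSwinnertonDyer.Theorems.EisensteinPrimesBSDpOnCellCOfCitedFactsV20
import Summits.BirchSwinnertonDyer.BirchSwinnertonDyer.Theorems.EisensteinPrimesBSDpOnCellCOfNamedFactsV24
import Summits.BirchSwinnertonDyer.BirchSwinnertonDyer.Theorems.EisensteinPrimesBSDpOnCellCTelescopeWeightTwoPseudoNullOfPub21
import Summits.BirchSwinnertonDyer.BirchSwinnertonDyer.Theorems.EisensteinPrimesBSDpOnCellCTelescopeK2WeightTwoControlOfPub21
import Summits.BirchSwinnertonDyer.BirchSwinnertonDyer.Theorems.EisensteinPrimesBSDpOnCellCKolyvaginOfGZK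
import Summits.BirchSwinnertonDyer.BirchSwinnertonDyer.Theorems.EisensteinPrimesBSDpOnCellCTelescopeK2ModuleDivOfLeavesFPGM
import HarnessLib

/-!
# [telescope v21/v22 — width seat bsd-line-x2-p2 g27, 2026-08-31] CRUX 4 `BSDpOnCellC` FROM 20 REFEREED FACTS (NO CGLS 2022 Prop. 1.2.5, NO Kolyvagin Thm. A,
# NO Castella 2018 Thms. 2.10–2.11), KELLER–YIN ×3, T-An-2ʳ AND CRUX 3 — CUMULATIVE CONDITIONAL CLOSURE OF THE prop125 LANE OVER THE LEAD's R6, SORRY-FREE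
# (`--supports`, helper; CONDITIONAL — closes nothing; the registry is re-cut, if at all, only by a LEAD under a director word)

Crux 4 `BSDpOnCellC` (stmt-BirchSwinnertonDyer-19034), line «telescope» (v21 of record 9eb63b9f…/556; v22 = RESHAPE #74, LEAD g9, `stub_publishedFacts21`).
WHAT: * `bsdpOnCellC_of_citedFactsR8K (hPub) (hPre) (hRat) (hMazur)` with `hPub` = 21 refereed names = v22's `stub_publishedFacts21` text (= v21's
`stub_publishedFacts` minus `kolyvagin` and `thm210_thm211_bdpDisplay_pNew`, the `hPub` of the LEAD's R6 p796589) with EXACTLY the conjunct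
`prop125_characterGrSelmerDual_torsion_muZero_dim` REMOVED and the `kolyvagin` conjunct PUT BACK (the V24 head text); * `bsdpOnCellC_of_citedFactsR8
(hPub) (hPre) (hRat) (hMazur)` with `hPub` = **v22's `stub_publishedFacts21` text with EXACTLY the prop125 conjunct removed — 20 refereed names, every other
conjunct token-identical and in the same nesting** := R8K fed the rebuilt 21-tuple whose `kolyvagin` conjunct is the TREE THEOREM
`EisensteinPrimesBSDpOnCellCKolyvaginOfGZK.forall_kolyvagin_of_rank_eq_analyticRank h10 h6 h8` (LEAD g9, exactly as R4/R6). `hPre` (Keller–Yin ×3 =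
`stub_preprintFacts3`), `hRat` (T-An-2ʳ), `hMazur` (crux 3) token-identical to R3…R7. PROOF of R8K = R7's term (this seat) with the head
`…OfNamedFactsV23.bsdpOnCellC_of_namedFactsV23P` ↦ `…OfNamedFactsV24.bsdpOnCellC_of_namedFactsV24P` (V23 × the LEAD's all-P residual layer) and the two
weight-two K2 leaves ↦ their 21-text twins `TelescopeK2WeightTwoControlOfPub21.weightTwoControlOfPub_of_pseudoNull_lzz21` /
`TelescopeWeightTwoPseudoNullOfPub21.weightTwoPseudoNullOfPub_lzz21` (twins of the LEAD's `_lzz` leaves); the FPGM glue and every other node unchanged.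
MEANING (host language, for the record only): the kernel certificate that the prop125 lane (x2-p2 g27, bricks p787997 … p796959, R7) COMPOSES with the
LEAD's K-lane/CAS-lane (R4–R6): by name 20 refereed + KY24 ×3 + T-An-2ʳ + crux 3. HONEST LABELS: CONDITIONAL result (the gate records it as such); it
discharges none of its hypotheses; closes no registered stub, no crux, no summit statement; the by-name register OF RECORD is whatever the host books on
the registered skeleton (v21: 27 + crux 3; v22 when RESHAPE #74 lands: 25 + crux 3) and is NOT changed by this file; a re-cut of `stub_publishedFacts21`
without prop125 is a LEAD act under a NEW director word (host (C2)/(C4)); host watch h-W-CAS-1 (LZZ `p`-range) inherited from the all-P layer. BSD is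
proved for no curve by this file. THEOREMS ONLY: no definition, no named fact, no instance, no `sorry`.
References (shape only): [cite: CastellaGrossiLeeSkinner2022, Prop. 1.2.5 (removed), Cor. 1.2.6, Thm. 2.1.2] [cite: Kolyvagin1990, Thm. A (rebuilt)]
[cite: Darmon2004, Thm. 3.22] [cite: LiuZhangZhang2018, Thms. 1.5.1, 1.5.3] [cite: KellerYin2024, Thm. 3.0.8, Thm. 2.2.2 (arXiv:2402.12781v2)] [cite: GreenbergVatsal2000, Thm. (1.3)]
-/

set_option autoImplicit false
set_option linter.dupNamespace false

noncomputable section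

open scoped Classical MatrixGroups ModularForm

open CongruenceSubgroup WeierstrassCurve NumberField IsDedekindDomain Field PowerSeries
  Literature.NumberTheory.EllipticCurves Literature.NumberTheory.EllipticCurves.GreenbergSelmer
  Literature.NumberTheory.EllipticCurves.ModularForms Literature.NumberTheory.QuadraticFields
  Literature.NumberTheory.EllipticCurves.Rank1Residual
  Literature.NumberTheory.EllipticCurves.Rank1Residual.Typed
  Literature.NumberTheory.EllipticCurves.KrizLi2019
  Literature.NumberTheory.EllipticCurves.GreenbergVatsal2000
  Literature.NumberTheory.EllipticCurves.Wuthrich2014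
  Literature.NumberTheory.EllipticCurves.SteinWuthrich2013
  Literature.NumberTheory.EllipticCurves.Castella2018Exceptional
  Literature.NumberTheory.GaloisRepresentations Literature.NumberTheory.GaloisCohomology
  Literature.NumberTheory.Automorphic
  Summit.BirchSwinnertonDyer.Rank1Residual.X11b.AcSelmer
  Summit.BirchSwinnertonDyer.Rank1Residual.X11b.Halves
  Summit.BirchSwinnertonDyer.Rank1Residual.X11b
  Summit.BirchSwinnertonDyer.Rank1Residual Summit.BirchSwinnertonDyer.Rank1Residual.X1
  Summit.BirchSwinnertonDyer.Rank1Residual.X2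
open Literature.NumberTheory.EllipticCurves.KellerYin2024 (curveLocalLambda)


open Literature.NumberTheory.EllipticCurves.BigGaloisRep

namespace Summit.BirchSwinnertonDyer.BirchSwinnertonDyer.Theorems.EisensteinPrimesBSDpOnCellCOfCitedFactsR8

open Literature.NumberTheory.EllipticCurves.CastellaGrossiLeeSkinner2022 Literature.NumberTheory.EllipticCurves.Castella2018
  Literature.NumberTheory.IwasawaTheory Literature.NumberTheory.IwasawaTheory.Greenberg2016
  Literature.NumberTheory.IwasawaTheory.Greenberg2006
  Summit.BirchSwinnertonDyer.Rank1Residual.X1.KellerYinMuLambdaSplit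
open Literature.NumberTheory.EllipticCurves.KellerYin2024
open Summit.BirchSwinnertonDyer.BirchSwinnertonDyer.Theorems

/-- **Crux 4 `BSDpOnCellC` from 21 refereed facts (v22's `stub_publishedFacts21` minus CGLS Prop. 1.2.5, `kolyvagin` kept), Keller–Yin ×3, T-An-2ʳ and crux 3**
(telescope chain with the FPGM glue, the V24P head and the 21-text weight-two leaves; conditional closure). CONDITIONAL: nothing here discharges the hypotheses.
[cite: KellerYin2024, Thm. 3.0.8 (shape only)] [cite: GreenbergVatsal2000, Thm. (1.3) (shape only)] [cite: LiuZhangZhang2018, Thms. 1.5.1, 1.5.3 (shape only)] -/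
theorem bsdpOnCellC_of_citedFactsR8K
    (hPub :
    (((lambdaMu_multiplicative_of_gvPar ∧ thm16_charIdeal_dvd_multiplicative_of_reducible ∧
    thm61_splitMultiplicative ∧ thm61_nonsplitMultiplicative ∧
    (∀ (W : WeierstrassCurve ℚ) [W.IsElliptic] [W.IsGloballyMinimal] (p : ℕ) [Fact p.Prime],
      greenberg_stevens (W := W) (p := p)) ∧
    exists_isNewformOf ∧
    hsieh2014_exists_anticyclotomicPAdicLFunction ∧
    (∀ (N : ℕ) [NeZero N] (W : WeierstrassCurve ℚ) (K : Type) [Field K] [NumberField K],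
      gross_zagier N W K) ∧
    (∀ (N : ℕ) [NeZero N] (W : WeierstrassCurve ℚ) (K : Type) [Field K] [NumberField K],
      kolyvagin N W K) ∧
    rank_eq_analyticRank_of_analyticRank_le_one ∧ HoffsteinLuo1997_exists_twist_L_one_ne_zero ∧
    mazur_not_dvd_maninConstant_of_odd ∧ bsdRHS_eq_of_isIsogenous) ∧
    LiuZhangZhang2018.thm151_thm153_modularCurve_heegnerVector) ∧
    (cor126_residualCharacter_globalLift ∧ cor126_residualCharacter_localSurjective ∧
      thm212_exists_isKatzLFunction ∧
      Literature.NumberTheory.EllipticCurves.Castella2018.cas20_thm211_memberForms_sigmaFrames_congr)) ∧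
      Literature.NumberTheory.EllipticCurves.BCGKPST2020.thm331_rubin_exists_katzMeasure₂_pseudoIso_span_eq ∧
      Literature.NumberTheory.EllipticCurves.DeShalit1987.thmII64_katzMeasure₂_functionalEquation ∧
      Literature.NumberTheory.EllipticCurves.Hida2010MuInvariant.thmI_mu_katzBranch_reflect_eq_zero)
    (hPre :
    Literature.NumberTheory.EllipticCurves.KellerYin2024.thm308_imc2_hidaMember_dvd_OPEN ∧
      Literature.NumberTheory.EllipticCurves.KellerYin2024.thm222_anacong_hidaMember_sigma_mu_OPEN ∧
      Literature.NumberTheory.EllipticCurves.KellerYin2024.thm222_anacong_hidaMember_sigma_lambda_OPEN)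
    (hRat : Literature.NumberTheory.EllipticCurves.hida1986_castella2020_exists_rationalMembers_on_pNewBranchChart)
    (hMazur :
    Summit.BirchSwinnertonDyer.BirchSwinnertonDyer.Theses.EisensteinPrimes.MazurMCOnCellB) :
    Summit.BirchSwinnertonDyer.BirchSwinnertonDyer.Theses.EisensteinPrimes.BSDpOnCellC :=
  Summit.BirchSwinnertonDyer.BirchSwinnertonDyer.Theorems.EisensteinPrimesBSDpOnCellCOfNamedFactsV24.bsdpOnCellC_of_namedFactsV24P hPub hPre
    (Summit.BirchSwinnertonDyer.BirchSwinnertonDyer.Theorems.TelescopeCarrierOfAnDistRatOfAlgFPG.carrier_of_anDistRat_of_algFP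
      (Summit.BirchSwinnertonDyer.BirchSwinnertonDyer.Theorems.TelescopeCarrierAnDistRatGalOfGaloisLattice.carrierAnDistRatGal_of_galoisLattice
        (Summit.BirchSwinnertonDyer.BirchSwinnertonDyer.Theorems.TelescopeBranchGaloisLatticeOfUntwistedFact.galoisLattice_of_untwistedGaloisLattice
          (Summit.BirchSwinnertonDyer.BirchSwinnertonDyer.Theorems.TelescopeBranchUntwistedOfFrobenius.untwistedGaloisLattice_of_frobeniusGaloisLattice
            (Summit.BirchSwinnertonDyer.BirchSwinnertonDyer.Theorems.TelescopeBranchFrobeniusLatticeOfChart.frobeniusGaloisLattice_of_rationalMembers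
              hRat))))
      (Summit.BirchSwinnertonDyer.BirchSwinnertonDyer.Theorems.TelescopeCarrierAlgOfWitnessFPG.carrierAlg_of_witness
        (Summit.BirchSwinnertonDyer.BirchSwinnertonDyer.Theorems.TelescopeCarrierAlgWOfDivIntFPG.carrierAlgW_of_divInt
          (Summit.BirchSwinnertonDyer.BirchSwinnertonDyer.Theorems.TelescopeK2DivIntOfModuleDivFPG.carrierDivInt_of_branchFibreDiv
            (Summit.BirchSwinnertonDyer.BirchSwinnertonDyer.Theorems.TelescopeK2ModuleDivOfLeavesFPGM.branchFibreDiv_of_leaves_of_modCofinite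
              Summit.BirchSwinnertonDyer.BirchSwinnertonDyer.Theorems.TelescopeBranchLatticeOfPkgG.branchLattice_of_pkgG
              (Summit.BirchSwinnertonDyer.BirchSwinnertonDyer.Theorems.TelescopeK2WeightTwoControlOfPub21.weightTwoControlOfPub_of_pseudoNull_lzz21
                Summit.BirchSwinnertonDyer.BirchSwinnertonDyer.Theorems.TelescopeWeightTwoPseudoNullOfPub21.weightTwoPseudoNullOfPub_lzz21
                hPub)
              Summit.BirchSwinnertonDyer.BirchSwinnertonDyer.Theorems.TelescopeMemberControlModCofinite.stub_memberControlModCofinite)))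
        Summit.BirchSwinnertonDyer.BirchSwinnertonDyer.Theorems.TelescopeHerbrandTranslate.stub_herbrandTranslate))
    hMazur

/-- **Crux 4 `BSDpOnCellC` from 20 refereed facts — telescope v22's `stub_publishedFacts21` text with EXACTLY the conjunct
`prop125_characterGrSelmerDual_torsion_muZero_dim` removed — Keller–Yin ×3, T-An-2ʳ and crux 3** := `bsdpOnCellC_of_citedFactsR8K` fed the rebuilt 21-tuple
(`kolyvagin` from Darmon Thm. 3.22 + modularity + Gross–Zagier, the LEAD's `…KolyvaginOfGZK.forall_kolyvagin_of_rank_eq_analyticRank`, as R4/R6).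
CONDITIONAL: nothing here discharges the hypotheses. [cite: Kolyvagin1990, Thm. A (shape only)] [cite: Darmon2004, Thm. 3.22 (shape only)] -/
theorem bsdpOnCellC_of_citedFactsR8
    (hPub :
    (((lambdaMu_multiplicative_of_gvPar ∧ thm16_charIdeal_dvd_multiplicative_of_reducible ∧
    thm61_splitMultiplicative ∧ thm61_nonsplitMultiplicative ∧
    (∀ (W : WeierstrassCurve ℚ) [W.IsElliptic] [W.IsGloballyMinimal] (p : ℕ) [Fact p.Prime],
      greenberg_stevens (W := W) (p := p)) ∧
    exists_isNewformOf ∧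
    hsieh2014_exists_anticyclotomicPAdicLFunction ∧
    (∀ (N : ℕ) [NeZero N] (W : WeierstrassCurve ℚ) (K : Type) [Field K] [NumberField K],
      gross_zagier N W K) ∧
    rank_eq_analyticRank_of_analyticRank_le_one ∧ HoffsteinLuo1997_exists_twist_L_one_ne_zero ∧
    mazur_not_dvd_maninConstant_of_odd ∧ bsdRHS_eq_of_isIsogenous) ∧
    LiuZhangZhang2018.thm151_thm153_modularCurve_heegnerVector) ∧
    (cor126_residualCharacter_globalLift ∧ cor126_residualCharacter_localSurjective ∧
      thm212_exists_isKatzLFunction ∧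
      Literature.NumberTheory.EllipticCurves.Castella2018.cas20_thm211_memberForms_sigmaFrames_congr)) ∧
      Literature.NumberTheory.EllipticCurves.BCGKPST2020.thm331_rubin_exists_katzMeasure₂_pseudoIso_span_eq ∧
      Literature.NumberTheory.EllipticCurves.DeShalit1987.thmII64_katzMeasure₂_functionalEquation ∧
      Literature.NumberTheory.EllipticCurves.Hida2010MuInvariant.thmI_mu_katzBranch_reflect_eq_zero)
    (hPre :
    Literature.NumberTheory.EllipticCurves.KellerYin2024.thm308_imc2_hidaMember_dvd_OPEN ∧
      Literature.NumberTheory.EllipticCurves.KellerYin2024.thm222_anacong_hidaMember_sigma_mu_OPEN ∧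
      Literature.NumberTheory.EllipticCurves.KellerYin2024.thm222_anacong_hidaMember_sigma_lambda_OPEN)
    (hRat : Literature.NumberTheory.EllipticCurves.hida1986_castella2020_exists_rationalMembers_on_pNewBranchChart)
    (hMazur :
    Summit.BirchSwinnertonDyer.BirchSwinnertonDyer.Theses.EisensteinPrimes.MazurMCOnCellB) :
    Summit.BirchSwinnertonDyer.BirchSwinnertonDyer.Theses.EisensteinPrimes.BSDpOnCellC := by
  obtain ⟨⟨⟨⟨h1, h2, h3, h4, h5, h6, h7, h8, h10, h11, h12, h13⟩, h15⟩, hB⟩, h21, h22, h23⟩ := hPub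
  exact bsdpOnCellC_of_citedFactsR8K
    ⟨⟨⟨⟨h1, h2, h3, h4, h5, h6, h7, h8,
      EisensteinPrimesBSDpOnCellCKolyvaginOfGZK.forall_kolyvagin_of_rank_eq_analyticRank h10 h6 h8,
      h10, h11, h12, h13⟩, h15⟩, hB⟩, h21, h22, h23⟩ hPre hRat hMazur

end Summit.BirchSwinnertonDyer.BirchSwinnertonDyer.Theorems.EisensteinPrimesBSDpOnCellCOfCitedFactsR8

end
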